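import Literature.MathematicalPhysics.QuantumFieldTheory.WilsonFinTorusPartition
import HarnessLib

/-!
# The cold period-doubling defect controls the trace excess of Lüscher's transfer matrix

Support lemmas for item `RecursionToGap` (stmt-QuantumFields-17755) of route `DoublingDefect`
(`QuantumFields/YangMills`): the spectral half of the glue, over the tree's transfer-matrix toolkit
(`WilsonTorusTransferMatrix`, `WilsonFinTorusPartition`: `Z(N³ × t) = Σᵢ λᵢ^t`, `0 ≤ λᵢ ≤ λ_{i₀} = λ₊ =
transferSpectralRadius`).  With `x_t := traceExcess ρ β N t = Z(N³ × t)/λ₊^t − 1 = Σ_{i ≠ i₀} (λᵢ/λ₊)^t`: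

* `coldDefect_nonneg` — `0 ≤ 1 − Z(N³ × 2t)/Z(N³ × t)²` for `t ≥ 2` (`Σ λ^{2t} ≤ (Σ λ^t)²`);
* `traceExcess_le_of_coldDefect_le` — if `1 − Z(N³ × 2t)/Z(N³ × t)² ≤ η ≤ 1/2` then `x_t ≤ 2η`
  (`Σ λ^{2t} ≤ λ₊^t Σ λ^t`, so `1 − δ ≤ λ₊^t / Z(N³ × t) = 1/(1 + x_t)`);
* `traceExcess_le_exp_of_le` — if `x_{t₀} ≤ e^{−c t₀}` then `x_t ≤ e^{−c t}` for every `t ≥ t₀ ≥ 2`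
  (each ratio `λᵢ/λ₊`, `i ≠ i₀`, is at most `e^{−c}`, and `x_t ≤ (max ratio)^{t−t₀} x_{t₀}`): smallness of the
  defect at ONE cold shape `t₀ × N³` propagates to all colder shapes — the cold-pressure bound consumed by
  `uniformClustering_of_coldPressure`.
[folklore]
-/

noncomputable section

open scoped BigOperators Topology
open MeasureTheory Filter
open Literature.MathematicalPhysics.QuantumFieldTheory

namespace Summit.QuantumFields.YangMills.Theorems.DoublingDefect

variable {G : Type} [Group G] [TopologicalSpace G] [IsTopologicalGroup G] [CompactSpace G]
  [MeasurableSpace G] [BorelSpace G] [SecondCountableTopology G] {n : ℕ} {ρ : G →* Matrix (Fin n) (Fin n) ℂ}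

/-- **The cold period-doubling defect is non-negative**: `0 ≤ 1 − Z(N³ × 2t)/Z(N³ × t)²` for `t ≥ 2`,
`β ≥ 0`, continuous unitary `ρ`. [folklore] -/
theorem coldDefect_nonneg (hρ : Continuous ρ) (hρu : ∀ g, ρ g ∈ Matrix.unitaryGroup (Fin n) ℂ)
    {β : ℝ} (hβ : 0 ≤ β) (N t : ℕ) [NeZero N] (ht : 2 ≤ t) :
    0 ≤ 1 - wilsonFinTorusPartition ρ β N N N (2 * t) / wilsonFinTorusPartition ρ β N N N t ^ 2 := by
  have hZ : 0 < wilsonFinTorusPartition ρ β N N N t := wilsonFinTorusPartition_pos hρ β N N N t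
  have h := wilsonFinTorusPartition_two_mul_le_sq hρ hρu hβ N t ht
  rw [sub_nonneg, div_le_one (pow_pos hZ 2)]
  exact h

/-- **Spectral bookkeeping of the trace excess.**  For `β ≥ 0` and continuous unitary `ρ` there are ratios
`rᵢ = λᵢ/λ₊ ∈ [0, 1]` (indexed by a countable eigenbasis) and an index `i₀` with `r_{i₀} = 1` such that for
every `m`, `Σᵢ rᵢ^{m+2} = Z(N³ × (m+2))/λ₊^{m+2}` and the trace excess is the sum over `i ≠ i₀`:
`HasSum (update (rᵢ^{m+2}) i₀ 0) (traceExcess ρ β N (m+2))`. [folklore] -/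
theorem exists_ratios_hasSum_traceExcess (hρ : Continuous ρ) (hρu : ∀ g, ρ g ∈ Matrix.unitaryGroup (Fin n) ℂ)
    {β : ℝ} (hβ : 0 ≤ β) (N : ℕ) [NeZero N] :
    ∃ (ι : Type) (_ : DecidableEq ι) (r : ι → ℝ) (i₀ : ι), (∀ i, 0 ≤ r i ∧ r i ≤ 1) ∧ r i₀ = 1 ∧
      0 < transferSpectralRadius ρ β N ∧
      (∀ m : ℕ, HasSum (fun i => r i ^ (m + 2))
        (wilsonFinTorusPartition ρ β N N N (m + 2) / transferSpectralRadius ρ β N ^ (m + 2))) ∧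
      ∀ m : ℕ, HasSum (Function.update (fun i => r i ^ (m + 2)) i₀ 0) (traceExcess ρ β N (m + 2)) := by
  classical
  obtain ⟨s, _, b, lam, i₀, -, hle, hL0, -, -, hrad, hZ⟩ :=
    exists_spectralData_wilsonTorusTransferMatrix N hρ hρu hβ
  refine ⟨s, inferInstance, fun i => lam i / lam i₀, i₀, fun i => ⟨div_nonneg (hle i).1 hL0.le,
    (div_le_one hL0).2 (hle i).2⟩, div_self hL0.ne', by rw [hrad]; exact hL0, fun m => ?_, fun m => ?_⟩
  · have h := (hZ m).div_const (lam i₀ ^ (m + 2))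
    rw [← wilsonFinTorusPartition_eq_cyclicPartition hρ hρu β N (m + 2), ← hrad] at h
    refine h.congr_fun fun i => ?_
    rw [hrad, div_pow]
  · have h := (hZ m).div_const (lam i₀ ^ (m + 2))
    have h1 : HasSum (fun i => (lam i / lam i₀) ^ (m + 2))
        (cyclicPartition ρ β N (m + 2) / lam i₀ ^ (m + 2)) := by
      refine h.congr_fun fun i => ?_
      rw [div_pow]
    have h2 := h1.update i₀ 0
    rw [div_self hL0.ne', one_pow] at h2
    have hx : traceExcess ρ β N (m + 2) = 0 - 1 + cyclicPartition ρ β N (m + 2) / lam i₀ ^ (m + 2) := by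
      unfold traceExcess
      rw [hrad]
      ring
    rw [hx]
    exact h2

/-- **A small cold defect forces a small trace excess**: if `1 − Z(N³ × 2t)/Z(N³ × t)² ≤ η ≤ 1/2` with
`t = m + 2 ≥ 2`, then `traceExcess ρ β N t ≤ 2η` (`β ≥ 0`, continuous unitary `ρ`).  Proof:
`Z(N³ × 2t) = Σ λᵢ^{2t} ≤ λ₊^t Σ λᵢ^t`, so `1 − η ≤ Z(2t)/Z(t)² ≤ λ₊^t/Z(t) = 1/(1 + x_t)`. [folklore] -/
theorem traceExcess_le_of_coldDefect_le (hρ : Continuous ρ) (hρu : ∀ g, ρ g ∈ Matrix.unitaryGroup (Fin n) ℂ)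
    {β : ℝ} (hβ : 0 ≤ β) (N m : ℕ) [NeZero N] {η : ℝ} (hη : η ≤ 1 / 2)
    (hδ : 1 - wilsonFinTorusPartition ρ β N N N (2 * (m + 2)) / wilsonFinTorusPartition ρ β N N N (m + 2) ^ 2 ≤ η) :
    traceExcess ρ β N (m + 2) ≤ 2 * η := by
  obtain ⟨ι, _, r, i₀, hr, hri₀, hpos, hT, hx⟩ := exists_ratios_hasSum_traceExcess hρ hρu hβ N
  set lp : ℝ := transferSpectralRadius ρ β N with hlp
  set W₁ : ℝ := wilsonFinTorusPartition ρ β N N N (m + 2) with hW₁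
  set W₂ : ℝ := wilsonFinTorusPartition ρ β N N N (2 * (m + 2)) with hW₂
  have hW₁pos : 0 < W₁ := wilsonFinTorusPartition_pos hρ β N N N (m + 2)
  -- `T = W₁/λ₊^{t}`, `T₂ = W₂/λ₊^{2t}`; `T₂ ≤ T`, `1 ≤ T`
  have hT₁ := hT m
  have hT₂ : HasSum (fun i => r i ^ (2 * m + 2 + 2)) (W₂ / lp ^ (2 * (m + 2))) := by
    have h := hT (2 * m + 2)
    rw [show 2 * m + 2 + 2 = 2 * (m + 2) from by ring] at h ⊢
    exact h
  have hle : ∀ i, r i ^ (2 * m + 2 + 2) ≤ r i ^ (m + 2) := fun i =>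
    pow_le_pow_of_le_one (hr i).1 (hr i).2 (by omega)
  have hT21 : W₂ / lp ^ (2 * (m + 2)) ≤ W₁ / lp ^ (m + 2) := hasSum_le hle hT₂ hT₁
  have hTge : 1 ≤ W₁ / lp ^ (m + 2) := by
    have h := le_hasSum hT₁ i₀ fun j _ => pow_nonneg (hr j).1 _
    simpa [hri₀] using h
  -- the defect in terms of `T`: `W₂/W₁² = (W₂/λ₊^{2t}) / (W₁/λ₊^t)²`
  have hlp0 : 0 < lp := hpos
  have hid : W₂ / W₁ ^ 2 = (W₂ / lp ^ (2 * (m + 2))) / (W₁ / lp ^ (m + 2)) ^ 2 := by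
    have h1 : lp ^ (m + 2) ≠ 0 := pow_ne_zero _ hlp0.ne'
    have h2 : W₁ ≠ 0 := hW₁pos.ne'
    field_simp
    ring
  set T : ℝ := W₁ / lp ^ (m + 2) with hTdef
  have hTpos : 0 < T := lt_of_lt_of_le one_pos hTge
  -- `1 - η ≤ W₂/W₁² ≤ T/T² = 1/T`
  have h1 : 1 - η ≤ W₂ / W₁ ^ 2 := by linarith
  have h2 : W₂ / W₁ ^ 2 ≤ 1 / T := by
    rw [hid]
    calc W₂ / lp ^ (2 * (m + 2)) / T ^ 2 ≤ T / T ^ 2 :=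
          div_le_div_of_nonneg_right hT21 (sq_nonneg _)
      _ = 1 / T := by field_simp
  have h3 : T * (1 - η) ≤ 1 := by
    have h := h1.trans h2
    rwa [le_div_iff₀ hTpos, mul_comm] at h
  have hη0 : 0 ≤ η := by nlinarith
  have hT2 : T ≤ 2 := by nlinarith
  -- `x = T - 1 ≤ T η ≤ 2 η`
  have hxT : traceExcess ρ β N (m + 2) = T - 1 := by
    have h := hx m
    have h' : HasSum (Function.update (fun i => r i ^ (m + 2)) i₀ 0) (0 - 1 + T) := by
      have := hT₁.update i₀ 0
      simpa [hri₀] using this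
    have := h.unique h'
    linarith
  rw [hxT]
  nlinarith

/-- **One cold shape controls all colder ones**: if `traceExcess ρ β N t₀ ≤ e^{−c t₀}` with `t₀ = m + 2`, then
`traceExcess ρ β N t ≤ e^{−c t}` for every `t = k + 2 ≥ t₀` (`β ≥ 0`, continuous unitary `ρ`).  Proof: every
ratio `rᵢ = λᵢ/λ₊` with `i ≠ i₀` has `rᵢ^{t₀} ≤ x_{t₀} ≤ (e^{−c})^{t₀}`, hence `rᵢ ≤ e^{−c}` and
`rᵢ^t ≤ rᵢ^{t₀} e^{−c (t − t₀)}`; sum over `i ≠ i₀`. [folklore] -/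
theorem traceExcess_le_exp_of_le (hρ : Continuous ρ) (hρu : ∀ g, ρ g ∈ Matrix.unitaryGroup (Fin n) ℂ)
    {β : ℝ} (hβ : 0 ≤ β) (N : ℕ) [NeZero N] {m k : ℕ} (hmk : m ≤ k) {c : ℝ}
    (h₀ : traceExcess ρ β N (m + 2) ≤ Real.exp (-(c * ((m + 2 : ℕ) : ℝ)))) :
    traceExcess ρ β N (k + 2) ≤ Real.exp (-(c * ((k + 2 : ℕ) : ℝ))) := by
  obtain ⟨ι, _, r, i₀, hr, hri₀, -, -, hx⟩ := exists_ratios_hasSum_traceExcess hρ hρu hβ N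
  have hx₀ := hx m
  have hxk := hx k
  set q : ℝ := Real.exp (-c) with hq
  have hq0 : 0 ≤ q := (Real.exp_pos _).le
  have hexp : ∀ j : ℕ, Real.exp (-(c * (j : ℝ))) = q ^ j := fun j => by
    rw [hq, ← Real.exp_nat_mul]; ring_nf
  have hm2 : Real.exp (-(c * ((m + 2 : ℕ) : ℝ))) = q ^ (m + 2) := hexp (m + 2)
  have hk2 : Real.exp (-(c * ((k + 2 : ℕ) : ℝ))) = q ^ (k + 2) := hexp (k + 2)
  rw [hm2] at h₀
  rw [hk2]
  -- each term of the `t₀`-sum is at most the sum, hence `rᵢ ≤ q` for `i ≠ i₀`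
  have hg0 : ∀ i, 0 ≤ Function.update (fun i => r i ^ (m + 2)) i₀ 0 i := fun i => by
    rcases eq_or_ne i i₀ with rfl | hne
    · simp
    · rw [Function.update_of_ne hne]; exact pow_nonneg (hr i).1 _
  have hri : ∀ i, i ≠ i₀ → r i ≤ q := fun i hne => by
    have h1 : r i ^ (m + 2) ≤ traceExcess ρ β N (m + 2) := by
      have h := le_hasSum hx₀ i fun j _ => hg0 j
      rwa [Function.update_of_ne hne] at h
    exact (pow_le_pow_iff_left₀ (hr i).1 hq0 (by omega : m + 2 ≠ 0)).1 (h1.trans h₀)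
  -- termwise comparison of the `t`-sum with `q^{t - t₀}` times the `t₀`-sum
  have hcmp : ∀ i, Function.update (fun i => r i ^ (k + 2)) i₀ 0 i ≤
      q ^ (k - m) * Function.update (fun i => r i ^ (m + 2)) i₀ 0 i := fun i => by
    rcases eq_or_ne i i₀ with rfl | hne
    · simp
    · rw [Function.update_of_ne hne, Function.update_of_ne hne]
      have hsplit : r i ^ (k + 2) = r i ^ (k - m) * r i ^ (m + 2) := by
        rw [← pow_add]; congr 1; omega
      rw [hsplit]
      exact mul_le_mul_of_nonneg_right (pow_le_pow_left₀ (hr i).1 (hri i hne) _) (pow_nonneg (hr i).1 _)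
  have hsum := hasSum_le hcmp hxk (hx₀.mul_left (q ^ (k - m)))
  calc traceExcess ρ β N (k + 2) ≤ q ^ (k - m) * traceExcess ρ β N (m + 2) := hsum
    _ ≤ q ^ (k - m) * q ^ (m + 2) := mul_le_mul_of_nonneg_left h₀ (pow_nonneg hq0 _)
    _ = q ^ (k + 2) := by rw [← pow_add]; congr 1; omega

end Summit.QuantumFields.YangMills.Theorems.DoublingDefect

end
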